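import Summits.ABC.Statement

/-!
# ABC — LADDER (rev 1, 2026-08-17)

Summit `ABC` (`Summits/ABC/Statement.lean`): `ABC := Literature.Abc.ABCConjecture`, i.e. `∀ ε > 0, ∃ C > 0, ∀ a b c, IsABCTriple a b c → (c:ℝ) < C * (rad a b c)^(1+ε)` (unfolded by `ABC_iff`). Written
by the ladder seat `ladder-ABC-l1` (gen 2, planner). MARKDOWN ONLY: this file creates no route, no item, no prover seat; it is re-armed daily and superseded by the next revision.

Conventions. R = rad(abc); N = conductor; q(a,b,c) = log c / log R (quality); log_k = k-th iterated log. Route items are cited as `<RouteSlug>.<Decl>` (stmt-ABC-id) under `Summit.ABC.ABC.Theses`; tree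
facts and barriers by decl name. Sources (held, read for this revision; PDF pages): PastenShimura2024 = arXiv:1705.09251 (Thm 1.9, 1.10 p.7; Thm 1.12, 1.13, Conj 1.14, Thm 1.15 p.8; Conj 3.1, 3.2, Rem
3.3 p.13); Pasten2024 = arXiv:2312.03566 (Thm 1.4, Cor 1.5 pp.2-3); BLT2024 = Browning-Lichtman-Teravainen arXiv:2410.12234 (Prop 1.1, Thm 1.2 p.3); Lichtman2025 = arXiv:2505.13991 (Thm 1.1 p.3);
BombieriGubler2006 ch.12 (Conj 12.2.2, 12.2.3, (12.1) p.395; Conj 12.2.6 p.396; Thm 12.4.6 and 12.4.10 pp.414-415; Ex 12.4.13-14, Rem 12.4.15 p.416; Rem 12.4.18 p.417; Thm 12.5.12 p.424; Conj 12.5.14,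
12.5.15 p.426); EvertseGyory2015 section 4.6 ((4.6.2)-(4.6.4) pp.87-88); BakerWustholz2007 section 3.7 (pp.50-53). No `Summits/ABC/BARRIERS.md` exists (barriers read directly from
`Literature/Barriers/ABC/`). Negatives index (`ledger negatives --problem ABC`, 2 entries): BelyiSqueeze.DegBelyiLower (stmt-ABC-1205) and the old GQLD target SeparatingQuasiLogDerivatives
(stmt-ABC-1689) - neither is re-proposed below.

How to read a rung. STATEMENT (informal, exact) [source] / STATUS / LEAN (tree decl or one-line sketch) / BEARS ON (which open route or crux it would move) / WOULD NOT GIVE (why proving it alone is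
not progress on ABC, or exactly how far short of ABC it stops). Section 0 is the FLOOR (proved), sections 1-6 are the six ladders (A growth exponent, B elliptic-modular avatars, C regime cells, D
counting, E transcendence inputs, F negative side), section 7 lists what is NOT a rung (at or above the summit, or beside it), section 8 the known-in-print formal debt.

Rung census (rev 1): 29 rungs - A1-A6, B1-B6, C1-C8, D1-D3, E1-E3, F1-F3; 0 in tree as theorems; 28 OPEN in print, 1 (B5) true in print and formal debt only; the proved glue connecting rungs to `ABC`
is listed in 0.7.

## 0. Floor - what is proved

- 0.1 Exponential abc (all triples). Stewart-Tijdeman 1986: log c << R^15; Stewart-Yu 1991: log c << R^(2/3+ε); Stewart-Yu 2001: log c <= κ R^(1/3) (log R)^3 [EvertseGyory2015 (4.6.3) p.88;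
  PastenShimura2024 p.7; Pasten2024 p.2]. Gyory 2008: fully explicit c < exp(c(t) Q (log Q)^t), t = ω(abc) [EvertseGyory2015 (4.6.4) p.88]. Tree: named facts
  `Literature.Barriers.ABC.BakerMethodBounds` (`stewartYu1991_upperBound`, shape family `BakerShapeBound θ k`, `bakerShapeBound_third_three_iff`, `BakerMethodBounds_iff_stewartYu`), conditional
  derivation `BakerMethodBoundsYuInput.stewart_yu_holds_of_yu2007`; proved route glue `RibetTakahashiSplit.SubexpOfValuationProduct` (stmt-ABC-11013).
- 0.2 Subexponential abc in two cells. Pasten2024 Thm 1.4 (p.2): (1) if a <= c^(1-η) then log c <= η^(-1) exp(κ sqrt(log R * log_2 R)); (2) log c <= q * exp(κ sqrt(log R * log_2 R)) with q = min of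
  the largest prime factors of a, b, c; Cor 1.5: P(xy(x+y)) >= κ (log_2 y)^2 / log_3 y. Tree: named fact `BakerMethodBounds.pasten2024_thm_1_4_2`; conditional
  `BakerMethodBoundsPastenDecomposition.pasten2024_thm_1_4_1_holds_of`.
- 0.3 Global (product) bounds from Shimura curves [PastenShimura2024]: Thm 1.10 prod_{p|abc} v_p(abc) < K_ε R^(8/3+ε) (p.7; equivalently Thm 1.11, d(abc) << R^(8/3+ε)); Thm 1.12 semistable E:
  prod_{p|N} v_p(Δ_E) < K_ε N^(11/2+ε) (p.8); Thm 1.13 #(level-lowering primes of semistable E) < 6 log N / log log N + c; Thm 1.15 Tam(E) < K N^(11/2+ε) (E semistable away from S with >= 2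
  multiplicative primes); Thm 1.9 h(E) < (1/48+ε) N log N, effective, and (1/24+ε) N log log N under GRH (p.7); bounded Manin constant when additive reduction is confined to a fixed S (Rem 3.3 p.13).
- 0.4 Counting. de Bruijn: #{n <= x : rad n <= x^λ} = O(x^(λ+ε)), whence the trivial bound N_λ(X) << X^(2λ/3+ε) for abc triples of exponent λ in [1,X]^3 [BLT2024 Prop 1.1 p.3; Lichtman2025 Thm 1.1:
  O(N^(2/3)) at rad < c^(1-ε)]; BLT2024 Thm 1.2: N_λ(X) << X^(33/50) for λ in (0, 1.001) (p.3); Kane: X^(α+β+γ-1-ε) << S_{α,β,γ}(X) << X^(α+β+γ-1+ε) + X^(1+ε) for α+β+γ > 1 [BLT2024 p.3].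
- 0.5 Negative floor (all CONSISTENT with ABC). ε cannot be dropped: no C with c <= C rad(abc) for all triples (a = 1, c = 3^(2^n); BombieriGubler2006 Ex 12.4.13 p.416) - tree THEOREMS
  `Literature.Barriers.ABC.EpsilonCannotBeDropped.abc_no_uniform_constant`, `not_abc_epsilon_zero`; Stewart-Tijdeman 1986: infinitely many triples with log(c/R) > (4-δ) sqrt(log c)/log log c (B-G Thm
  12.4.6, 12.4.10 pp.414-415), constant 6.068 (van Frankenhuysen 2000, B-G Rem 12.4.18 p.417), 6.563 (Bright 2024; tree named fact `bright2024_lowerBound`); explicit quality floor q(2, 3^10 * 109,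
  23^5) = 1.62991 (B-G Ex 12.4.14; tree theorems `ExplicitABCQualityFloor.reyssat_quality_gt`, `exists_quality_gt`, `reyssat_quality_enclosure`); Szpiro's ε cannot be dropped (Masser 1990; tree
  `SzpiroEpsilonCannotBeDropped`, `not_szpiro_epsilon_zero`); the n-conjecture and Hall exponents are sharp (`NConjectureExponentSharp`, `HallExponentSharp`); uniform abc cannot have a log-power
  discriminant term (`UniformABCDiscriminantSharp.not_logPower`).
- 0.6 Closed cells. ω(abc) <= 2: `NegOmegaAtlas.TwoSlotCell` (stmt-ABC-1231, proved `Theorems.twoSlotCell_proof`).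
- 0.7 Proved route glue in tree (what makes the rungs below bear on `ABC`): IneffectiveSubspace AbcGivesUniformSadic (15071), UniformSadicGivesTowerFour (15070), TowerFourGivesDepthCounted (14940),
  UniformSadicGivesPrimePowerRadical (15167), TowerLiouvilleExponent (1650), AbcGivesTower (1652), CanonicalTowerLift (1654); CongruentialReceptacle Assembly (1728), TameLocalReceptacleGivesTarget
  (14493), QuarterWindowGivesCrux (15117), AbelianWeightsVanish (1726), CongruenceToEquality (1727); FeketeScales Assembly (2165), SubmultOfRST (10340), TargetOfCruxes (14163), PolynomialAbcOfSubmult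
  (2163), QuasiPolynomialAbcOfEpsSubmult (2164); RibetTakahashiSplit Assembly (11012), ManyPrimeFreyOfManyPrime (15151), SubexpManyPrimesOfValuationProduct (1570), ValuationProductOfCurves (1571),
  DiscrepancyPotentialBound (2637); DefiniteXi Assembly (11339), DefiniteGlue (11341), DegreeBoundToABCOfPetersson (11342), PeterssonOfSymmFour (15911), PolyDegreeToPolyABC (2027),
  MinimalBoundGivesTarget (3328); IsogenyGlueCongruence EdixhovenIntegrality (15990), FrameOverPetersson (10885), DegreePrimesOfGluingBound (13921), SemistableHeightPolyBoundOfMazurKenku (15128);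
  ParitySliceConcordantNorms Assembly (4016). Strong-hypothesis bridges (`Summits/ABC/StrongHypotheses.lean`): quality form <-> ABC, modified Szpiro <-> ABC (Oesterle 1988), generalized Szpiro (B-G
  12.5.11) <-> ABC and strong Hall <-> ABC (B-G Thm 12.5.12 p.424), Baker explicit -> ABC, uniform abc -> ABC, RST Conj A (upper) -> ABC.

## 1. Ladder A - the growth exponent (shape of the bound for ALL triples)

Floor: log c << R^(1/3)(log R)^3 (0.1). Summit: log c <= (1+ε) log R + O_ε(1).

- A1 BelowOneThird. STATEMENT: there are θ < 1/3 and κ with log c <= κ R^θ for every abc triple (any fixed improvement of the Stewart-Yu 2001 exponent) [StewartYu2001; EvertseGyory2015 p.88;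
  BakerWustholz2007 p.52: "to go significantly further some new ideas will be needed"]. STATUS open since 2001. LEAN: crux `LogCardinality.BelowOneThird` (stmt-ABC-11054, rank 4); barrier family
  `Literature.Barriers.ABC.BakerMethodBounds` (`BakerShapeBound θ k`: every linear-forms proof so far lands on a shape (θ,k) with θ >= 1/3). BEARS ON route-ABC-LogCardinality (deciding chain
  BakerRefinement -> PadicPowerSaving -> SubPowerStewartYu -> BelowOneThird; the proved-now upgrade lemma `PowerSavingUpgrade` stmt-ABC-11055 converts rung E1 into exactly A1); calibrates every
  transcendence-side crux (RTSplit FewPrimeHardCore, NegOmegaAtlas walls). WOULD NOT GIVE: any θ > 0 is still an EXPONENTIAL abc, c <= exp(κ R^θ); the residual step A1 -> ABC is the route's own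
  `LadderRemainder` (stmt-ABC-14512), rated summit-strength.
- A2 Valuation-product exponent below 8/3. STATEMENT: for some β < 8/3 (conjecturally every β > 0): for all ε there is K with prod_{p|abc} v_p(abc) < K R^(β+ε) for every abc triple [known β = 8/3:
  PastenShimura2024 Thm 1.10 p.7; β = 0 follows from ABC since prod v_p <= d(abc) << (abc)^ε]. STATUS open below 8/3. LEAN sketch: `∀ ε > 0, ∃ K, ∀ a b c, IsABCTriple a b c → ∏ p in
  (a*b*c).primeFactors, padicValNat p (a*b*c) < K * rad^(β+ε)`; tree relatives `RibetTakahashiSplit.ManyPrimeValuationProduct` (stmt-ABC-1561, the N^ε form on the many-prime part), `…SemistableFrey`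
  (15174), `ManyPrimeValuationProductFrey` (15149). BEARS ON route-ABC-RibetTakahashiSplit (r2 of closes = R2 ∧ R4 ∧ R3''), DefiniteXi `SteinbergCore` (15024). Since max_p v_p <= prod_p v_p, β < 1/3
  would ALSO give A1 (a Baker-shape bound with θ = β+ε) by a non-transcendence method - the one known engine (Shimura-curve degree comparison) that is "global in all primes at once" (Pasten p.7).
  WOULD NOT GIVE: even β = 0 yields only log c << R^ε log R, i.e. rung A3 (`RibetTakahashiSplit.SubexpOfValuationProduct`, proved) - still not polynomial.
- A3 Subexponential abc for all triples. STATEMENT: for every ε > 0 there is K_ε with log c <= K_ε R^ε [shape of Pasten2024 Thm 1.4 without the lopsided / small-prime hypothesis]. STATUS open (known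
  only in the two cells of 0.2). LEAN sketch: `∀ ε > 0, ∃ K, ∀ a b c, IsABCTriple a b c → Real.log c ≤ K * rad^ε`. BEARS ON RTSplit (target of its r2-glue), LogCardinality, NegOmegaAtlas
  (`UnbalancedQuasiPolynomial` 10558 is the certified wall just below it in one cell), LopsidedSzpiroSplit (what Pasten's cell theorem would become if η -> 0 were allowed). WOULD NOT GIVE: c <= exp(K
  R^ε) is astronomically weaker than polynomial; no application of abc (Fermat-type finiteness, Roth, squarefree values) follows from it.
- A4 Quasi-polynomial abc. STATEMENT: there are A, κ with log c <= κ (log R)^A for every abc triple. STATUS open. LEAN: conclusion of the proved glue `FeketeScales.QuasiPolynomialAbcOfEpsSubmult`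
  (stmt-ABC-2164: ε-submultiplicativity of record heights gives it); cell version certified in `NegOmegaAtlas.UnbalancedQuasiPolynomial` (10558). BEARS ON route-ABC-FeketeScales (first pay-off of
  `ScaleSubmultiplicativity` 2160) and Ladder E (E3 gives A4 in every bounded-ω cell; Baker's full Ξ-estimate E2+E3 gives log c << log R * log log c, i.e. A = 1 + o(1), for all triples). WOULD NOT
  GIVE: A = 1 exactly is needed even for weak abc; A > 1 still has no Diophantine finiteness consequence.
- A5 Polynomial (weak, Oesterle-type) abc. STATEMENT: there are κ, K with c < K R^κ for every abc triple [PastenShimura2024 Conj 1.2 p.3 "abc < rad(abc)^κ … Both conjectures are open"; B-G 12.2.3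
  p.395: abc with ONE fixed ε is the "weak abc-conjecture … often as useful as the strong one"]. STATUS open. LEAN: conclusion of the proved glue `FeketeScales.PolynomialAbcOfSubmult` (2163),
  `DefiniteXi.PolyDegreeToPolyABC` (2027); hypotheses typed as `DefiniteXi.PolyFreyDegree` (2026, open), `IsogenyGlueCongruence.PolyHeightOfBoundedPrimes` (16006) / `PolyDegreeOfBoundedPrimes` (2046),
  `IneffectiveSubspace` K-level Vojta towers (docstring of `UniformSadicTowerFour` 14937: level 4, K = 0 is "c << rad^(4+ε) for cube-free abc", reached by no engine). BEARS ON five routes at once - it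
  is THE mid-ladder milestone of FeketeScales, IneffectiveSubspace, DefiniteXi (weak rung `XiBoundUpgrade` 14722), IsogenyGlueCongruence (U/K-lines), CongruentialReceptacle (Szpiro 6+ε gives κ = 3,
  see B2). WOULD NOT GIVE: ABC is κ = 1+ε for EVERY ε; no amplification from a fixed κ to 1+ε is known for integers (the function-field proof gets 1 directly from Mason-Stothers; abc triples carry no
  product structure for a tensor-power trick) - the typed forms of this missing amplification, `IsogenyGlueCongruence.SharpDegreeOfPolyDegree` (10895) and `SharpDegreeOfPolyHeight` (16009), are rated
  abc-strength by their own route. Conversely weak abc with κ < 6/5 gives polynomial Szpiro (B1) through c4^3 - c6^2 = 1728Δ (the B-G Thm 12.5.12 argument with a fixed exponent).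
- A6 Explicit weak abc c < R^2 (side rung, INCOMPARABLE with ABC). STATEMENT: c < rad(abc)^2 for every abc triple [B-G (12.1) p.395, "conjectured by several authors as a likely explicit form of the
  weak abc-conjecture"; gives FLT for n >= 6 outright, Ex 12.2.4]. STATUS open; consistent with all data (record quality 1.62991 < 2, tree `ExplicitABCQualityFloor`, `ExplicitABCExponent θ`). BEARS ON
  kill criteria of NegOmegaAtlas / FeketeScales and on Baker's explicit refinement (constant 6/5, BakerWustholz2007 p.52; tree bridge `bakerExplicitABC_imp_abc` sits ABOVE the summit). WOULD NOT GIVE: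
  ABC (ε -> 0 with unknown constants) neither implies nor follows from c < R^2; it is listed because every applications chapter uses it and because an explicit inequality is the only kind a finite
  computation can refute.

## 2. Ladder B - elliptic and modular avatars (Frey curve E_{a,b}: 2^8 Δ_min = (abc)^2 up to 2-power, N | 2^k rad(abc))

- B1 Polynomial Szpiro / height conjecture. STATEMENT: there is κ with Δ_E < N_E^κ for all E/Q [PastenShimura2024 Conj 1.1 p.3, open]; equivalently-in-spirit Frey's height conjecture h(E) < κ log N_E
  [Conj 3.1 p.13] and the modular degree conjecture log δ_{1,N}(E) << log N_E [Conj 3.2; Rem 3.3: Frey's Manin-constant version is equivalent to the height conjecture (Mai-Murty); the plain version is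
  equivalent when additive reduction is confined to a fixed S, e.g. Frey-Hellegouarch curves - this "fills a gap in Theorem 1 of [MurtyBounds]"]. Known: only exponential (0.3: h(E) < (1/48+ε) N log
  N). STATUS open. LEAN: `IsogenyGlueCongruence.PolyHeightOfBoundedPrimes` (16006, "open exactly when polynomial Szpiro for semistable curves, Pasten Conj 3.1"), `SemistableHeightPolyBound` (13918),
  `DefiniteXi.XiBound` (11336, "unconditionally <-> polynomial Szpiro on Frey curves"), `DefiniteXi.PolyFreyDegree` (2026). BEARS ON DefiniteXi (weak rung), IsogenyGlueCongruence (H-line), and gives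
  A5 on restriction to Frey curves (`PolyDegreeToPolyABC` 2027 proved). WOULD NOT GIVE: exponent κ, not 6+ε; through Frey curves it yields only c << R^(κ/2)-type polynomial abc (A5), never 1+ε.
- B2 Szpiro with the sharp exponent for Frey curves. STATEMENT: for every ε there is C with Δ_min(E_{a,b}) <= C N^(6+ε) for all abc triples (Szpiro 6+ε on the Frey-Hellegouarch family; implied by ABC
  via generalized Szpiro, B-G Thm 12.5.12). STATUS open. LEAN: balanced-cell form `CongruentialReceptacle.BalancedFreySzpiro` (stmt-ABC-1723: (abc)^2 <= C rad^(6+ε) when min(a,b) >= κc);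
  isogenous-family form `LopsidedSzpiroSplit.SexticABC` (18361, draft route). BEARS ON route-ABC-CongruentialReceptacle (closes = TameLocalReceptacle 14354 -> CompactBalanceTransfer 1725 -> ABC
  through the proved Assembly 1728) and route-ABC-LopsidedSzpiroSplit (LopsidedABC -> SexticABC -> ABC). WOULD NOT GIVE: from (abc)^2 << R^(6+ε) one gets abc << R^(3+ε/2), hence full ABC on BALANCED
  triples (abc >= κ^2 c^3) but only c << R^(3+ε) in general - and every known high-quality triple is unbalanced (a = 1 or 2). The complement is rung C1 (lopsided abc) or the transfer C2. (Generalized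
  Szpiro max(|c4|^3, c6^2) <= C N^(6+ε) is EQUIVALENT to ABC and therefore not a rung: tree bridge `generalizedSzpiroBG_iff_abc`.)
- B3 Polynomial modular-degree bound with controlled congruence primes. STATEMENT: deg φ_E <= C N^A for semistable (or Frey) E with absolute A, C, obtained by bounding the congruence primes of f_E:
  (i) the primes ℓ at which f_E is congruent to another weight-2 form of the same level are polynomially bounded in number and size (`IsogenyGlueCongruence.DegreePrimesPolyBounded` 2045,
  `EllipticGluingPrimeBound` 13919, `TorsionSharingPrimeBound` 2157), and (ii) bounded congruence primes force polynomial degree / height (`PolyDegreeOfBoundedPrimes` 2046, `PolyHeightOfBoundedPrimes`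
  16006). Known: Pasten Thm 1.13 (#L(E) < 6 log N/log log N + c for level-LOWERING primes, 0.3); Ribet / Diamond congruence-modulus theory; deg φ | congruence number. STATUS open (each of (i), (ii)).
  BEARS ON route-ABC-IsogenyGlueCongruence (closes runs through lever U and the proved glue `DegreePrimesOfGluingBound` 13921, `SemistableHeightPolyBoundOfMazurKenku` 15128, `FrameOverPetersson`
  10885). WOULD NOT GIVE: the conclusion is A5/B1-strength (fixed exponent A); the sharp step deg φ <= C_ε N^(2+ε) (`SharpDegreeOfPolyDegree` 10895) is abc-strength, and the sharp conjecture itself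
  (`SemistableDegreeConjecture` 2044, `DefiniteXi.FreyDegreeBound` 2019) is at or above the summit (section 7).
- B4 Valuation products for elliptic curves below 11/2. STATEMENT: for some β < 11/2 (conjecturally every β > 0; β = 0 follows from Szpiro): prod_{p|N_E} v_p(Δ_E) < K_ε N_E^(β+ε) for all semistable
  E/Q [known β = 11/2: PastenShimura2024 Thm 1.12 p.8]. STATUS open below 11/2. LEAN: `RibetTakahashiSplit.ManyPrimeValuationProductSemistableFrey` (15174, rank 2), `ManyPrimeValuationProduct` (1561),
  `FewPrimeValuationProduct` (1563), `ThinWeightedSzpiro` (17927); `DefiniteXi.SteinbergCore` (15024: false iff a Frey family has coprimeSixPart(deg_min) * prod_{q|N} v_q(Δ_min) >= N^(2+δ)). BEARS ON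
  route-ABC-RibetTakahashiSplit (the JL / Ribet-Takahashi degree-comparison family route; proved glue `ValuationProductOfCurves` 1571, `ManyPrimeFreyOfManyPrime` 15151) and DefiniteXi. WOULD NOT GIVE:
  a PRODUCT bound N^ε gives only subexponential abc in the many-prime regime (`SubexpManyPrimesOfValuationProduct` 1570, proved); the few-prime / Pillai regime (`FewPrimeHardCore` 15197) and the thin
  weighted-Szpiro piece (17927) stay open and are rated abc-strength in their regimes by the route itself.
- B5 Level-lowering and isogeny inputs made uniform. STATEMENT: the printed finiteness inputs hold in the uniform, typed form the modular routes consume - Mazur-Kenku isogeny radius 163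
  (`MazurKenkuRadius` 15193, `MazurKenkuBound` 15125 split into `MazurCor44` 18223, `KenkuPrintedLevels` 18224, `KenkuCompositeTables` 18225, `KenkuLevelFortyNine` 18226), Edixhoven integrality
  (15990, PROVED), isogeny valuation transport (`DefiniteXi.IsogenyValuationTransport` 18928), semistable Manin bound (16013/16014), modularity datum (15126), Faltings-Tate (15664). STATUS: TRUE in
  print (Mazur 1978 Thm 1, Kenku 1982, Edixhoven 1991, Cesnavicius, Wiles / BCDT), formal debt only - listed as a rung because four modular routes are blocked on it, see section 8. BEARS ON
  IsogenyGlueCongruence, DefiniteXi, RTSplit (staffable supports). WOULD NOT GIVE: nothing toward ABC by itself (inputs, not estimates).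
- B6 Quaternionic ξ-bounds (definite algebra). STATEMENT: the degree-type invariant ξ of the Jacquet-Langlands transfer of f_E to a definite quaternion algebra ramified at the 2-adic / Steinberg
  primes is polynomially bounded in N for Frey curves (`DefiniteXi.XiBound` 11336), with the Eisenstein part quarantined (`EisensteinQuarantine` 15023) and the Steinberg core controlled
  (`SteinbergCore` 15024); inputs known in print: `DefiniteRTControlPrime` (11338, Takahashi 2001 Thm 2.3/3.8), `BrandtEigenLatticeRankOne` (17203, Pizer 1980 Thm 2.28), `SymmFourAnalyticPackage`
  (15853, Kim 2003 Thm B), `FreyModularity` (11340), `PeterssonLowerBound` (10870, Hoffstein-Lockhart 1994 + GHL). STATUS open (XiBound <-> polynomial Szpiro on Frey curves, i.e. B1 restricted). BEARS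
  ON route-ABC-DefiniteXi (weak rung wiring `XiBoundUpgrade` 14722; proved `DefiniteGlue` 11341, `DegreeBoundToABCOfPetersson` 11342). WOULD NOT GIVE: ABC needs `XiStrongBound` (11337, exponent 1+ε in
  the degree), which implies `FreyDegreeBound` by known facts and is therefore abc-strength.

## 3. Ladder C - regime cells (ABC restricted to a class of triples, and the gluing statements between cells)

- C1 Lopsided abc. STATEMENT: for every ε there is K with c < K R^(1+ε) for all abc triples with min(a,b) <= c^(1-ε) (`LopsidedSzpiroSplit.LopsidedABC` stmt-ABC-18360). Known in this cell:
  subexponential, log c <= η^(-1) exp(κ sqrt(log R log_2 R)) (Pasten2024 Thm 1.4(1)) - the only cell of generic triples where anything below exp(R^(1/3)) is proved. Intermediate rung C1': polynomial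
  or quasi-polynomial abc in the lopsided cell (improve Pasten's exp(sqrt(log R log_2 R)) to (log R)^A). STATUS open. BEARS ON draft route-ABC-LopsidedSzpiroSplit (closes: LopsidedABC -> SexticABC ->
  ABC) and, contrapositively, `CongruentialReceptacle.CompactBalanceTransfer` (1725). WOULD NOT GIVE: the balanced triples; but those are exactly where Szpiro 6+ε suffices (B2) - the pair (C1, B2) is
  a genuine two-piece cover of ABC. Caveat (route docstring): the lopsided cell contains ALL known extremal data (a = 1, c = 3^(2^n); Reyssat's a = 2), so C1 is abc-hard in the data sense even though
  c/b = 1 + a/b -> 1 makes the linear form nearly degenerate (the structure Pasten exploits).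
- C2 Balance transfer over Q. STATEMENT: ABC for balanced triples (min(a,b) >= κ c for each fixed κ > 0) implies ABC (`CongruentialReceptacle.CompactBalanceTransfer` 1725); with it,
  `TameLocalReceptacle` (14354: a residue-free local receptacle table forcing Szpiro 6+ε on balanced Frey curves). Known: a transfer of this kind IS a theorem in the bounded-degree setting (Mochizuki
  GenEll 2010 Thm 2.1, via noncritical Belyi maps: Vojta / abc for points of bounded degree follows from the case of points in a compactly bounded subset) - a statement over all number fields of
  bounded degree, not over Q alone. STATUS "open over Q" (route docstring: the one known transfer runs through a cover, so it consumes UNIFORM abc over number fields, a strong hypothesis above the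
  summit - `uniformABC_imp_abc`). BEARS ON route-ABC-CongruentialReceptacle (closes = TameLocalReceptacle -> CompactBalanceTransfer -> ABC). WOULD NOT GIVE: alone it is an implication between two open
  statements; its value is that it would let every Szpiro-type route (B2) stop at balanced triples.
- C3 Bounded-ω cells, k >= 3. STATEMENT (one rung per k): ABC - or Baker's refinement c <= κ N (log N)^k / k! - for abc triples with ω(abc) <= k [Baker 1998/2004 via BakerWustholz2007 p.52; explicit
  constant 6/5 supported by computation; refinement consistent with Stewart-Tijdeman's lower bound]. Known: k <= 2 closed (0.6); for k >= 3 only the exponential floor 0.1 (Gyory's (4.6.4) is c <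
  exp(c(k) R (log R)^k)) and Pasten2024 Thm 1.4(2) when one of a, b, c has only small prime factors. STATUS open for every k >= 3 (already p^x - q^y = 2^k r^z, Pillai type, is open). LEAN: negations
  typed as `NegOmegaAtlas.UnbalancedFamily` (1225), `BalancedFamily` (1226), `ThreeSlotFamily` (1227) with the proved-shape dichotomy `AtlasDichotomy` (1228) and certified walls
  `PrimeFloorBoundedOmega` (10559), `UnbalancedQuasiPolynomial` (10558); positive few-prime forms `RibetTakahashiSplit.FewPrimeHardCore` (15197), `FewPrimeValuationProduct` (1563);
  `LogCardinality.BakerRefinement` (1756) is the all-k form and sits ABOVE the summit (`bakerExplicitABC_imp_abc`). BEARS ON NegOmegaAtlas (each cell decided either way closes an atlas item), RTSplit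
  (r4 few-prime core), LogCardinality. WOULD NOT GIVE: bounded-ω triples are a thin family; ABC for all k separately does not give ABC (constants depend on k, and `IneffectiveSubspace.DeepRegimeABC`
  15121 - quality >= 1+δ with ω -> infinity - is untouched); conversely high-quality data has ω(abc) ~ 5-12, so small-k cells are also not where counterexamples are expected.
- C4 Depth cells (prime-power structure of abc). STATEMENT: the IneffectiveSubspace chain `UniformSadicTowerFour` (14937: a UNIFORM S-adic subspace statement on the level-4 Vojta tower X_4) ->
  `TowerFourSubLiouville` (1649: a sub-Liouville exponent A < 2 for γZ^4 - αX^4 = βY^4, uniform in the twist) -> `DepthCountedABC` (14938: abc with the radical weighted by depth, parameter K) plus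
  `PrimePowerRadical` (1648) and `DeepRegimeABC` (15121). Known: Vojta 2000 (abc-type inequalities on the towers X_n imply abc; K = 0 at level 4 would already be c << rad^(4+ε) for cube-free triples,
  reached by no engine); Ridout / subspace theorem per fixed data (ineffective, non-uniform). STATUS open at every level. BEARS ON route-ABC-IneffectiveSubspace (closes: UniformSadicTowerFour -> … ->
  ABC through proved glue 15070, 14940, 15167, 1650, 1652, 1654). WOULD NOT GIVE: `PrimePowerRadical` alone yields Wieferich-type corollaries (infinitely many non-Wieferich primes to each base,
  Silverman 1988 shape), not a bound on c; `DepthCountedABC` at fixed K is abc for (K-dependent)-power-free triples only; uniformity in the subspace theorem is the whole difficulty (Roth/Ridout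
  constants are ineffective AND non-uniform).
- C5 Powerful / k-full cells. STATEMENT: for k >= 4, only finitely many abc triples have a, b, c all k-full (R <= (abc)^(1/k) < c^(3/k), so q > k/3 >= 4/3 and ABC with ε < 1/3 gives finiteness);
  sharper counting forms `ExceptionalSetEnergy.PowerfulHitsSquareRoot` (2710), `SquarefulShapeEnergy` (2711), `ParitySliceConcordantNorms.SquareTopResidualFinite` (4015). Known: no finiteness theorem
  for any k (Darmon-Granville needs FIXED exponents (p,q,r) with 1/p+1/q+1/r < 1, B-G Rem 12.5.16; a k-full number is not a perfect power); k = 2 genuinely has infinitely many coprime solutions (Pell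
  families), consistent with ABC since 2-full forces only q >= 2/3; k = 3 forces q >= 1, the borderline ABC does not decide. STATUS open for every k >= 4. BEARS ON ExceptionalSetEnergy, ParitySlice,
  IneffectiveSubspace depth cells; it is the cleanest FINITENESS consequence of ABC with no known proof, hence the cheapest place to test any new engine. WOULD NOT GIVE: a zero-density slice;
  finiteness there says nothing about the quality of general triples (and the Stewart-Yu shape log c << R^(1/3)(log R)^3 cannot produce finiteness on any slice where R is a power of c below c).
- C6 Norm-form slices. STATEMENT: ABC on the slice of triples whose top c is a value of ONE fixed norm form, with a power-saving lower bound for the radical of the values of a fixed sextic norm form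
  (`ParitySliceConcordantNorms.GenericSliceLangevin` 4011), uniformity of the slice constants in the form (`SliceUniformity` 4012), and Y^ε point counts uniform in the twist on the concordant genus-1
  curves (`SliceHitsSubpolynomial` 4013); target `NonSquareTopABC` (4010) + `SquareTopResidualFinite` (4015) -> ABC (Assembly 4016 PROVED). Known: Langevin's slice results are conditional on abc;
  unconditional radical lower bounds for polynomial values are of log-power strength only. STATUS open. BEARS ON route-ABC-ParitySliceConcordantNorms. WOULD NOT GIVE: one slice with its own constant
  is consistent with ABC failing on other slices; `SliceUniformity` is where abc-strength re-enters.
- C7 Scale structure of record heights. STATEMENT: with G(R) = the largest c among abc triples of radical at most R: (i) `FeketeScales.ScaleSubmultiplicativity` (2160: log G is submultiplicative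
  across radical scales up to the RST-type slack), (ii) `SparseGoodScales` (2161: liminf log G(R)/log R <= 1, i.e. abc holds along SOME unbounded sequence of scales). Proved glue: (i) -> polynomial
  abc (2163), ε-(i) -> quasi-polynomial abc (2164), (i)+(ii) -> Target -> ABC (14163, 2165: Fekete's lemma turns submultiplicativity plus a good subsequence into lim <= 1). STATUS open ((ii) "false
  only if abc fails at EVERY large scale"; (i) "false iff record heights are incompressible across scales"). BEARS ON route-ABC-FeketeScales. WOULD NOT GIVE: (ii) alone controls a sparse set of scales
  and nothing between them; (i) alone stops at A5.
- C8 Global quasi-log-derivative cells. STATEMENT: existence of SMALL, COHERENT, non-constant ε-quasi-logarithmic derivatives separating every abc triple with a <> b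
  (`GlobalQuasiLogDerivative.SmallCoherentNonConstant` 1690, `Rigidity` 1691 for some ε < 2, `SeparationUpgrade` 11487, `PairGluingOneTwo` 13961; target `SeparatingQuasiLogDerivativesR` 11486) [Pasten
  2021 arithmetic-derivative reformulation; barrier `Literature.Barriers.ABC.NoArithmeticDerivative` (`IntegersHaveNoDerivation`, `arithDeriv_not_additive`)]. STATUS open; the ε >= 2 versions are
  FALSE (s = n^2, recorded in the docstrings) and the old target stmt-ABC-1689 is in the negatives index (degenerate triple (1,1,2)). BEARS ON route-ABC-GlobalQuasiLogDerivative (closes: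
  SmallCoherentNonConstant -> SeparationUpgrade -> Bridge -> ABC). WOULD NOT GIVE: `Rigidity` or `SmallCoherentNonConstant` alone are structure statements about the maps; only with `SeparationUpgrade`
  (the thin lattice L_ε must not glue a coprime pair) does a bound on c appear.

## 4. Ladder D - counting the exceptional set (N_λ(X) = number of abc triples of exponent λ in [1,X]^3)

- D1 Below 33/50. STATEMENT: N_λ(X) << X^θ for λ near 1 with some θ < 33/50 [BLT2024 Thm 1.2 p.3 gives 33/50 and "we expect the exponent can be reduced with substantial computer assistance"; trivial
  2/3: Prop 1.1, Lichtman2025 Thm 1.1]. Typed milestones: `ExceptionalSetEnergy.HitCountFourSevenths` (2708, θ = 4/7 as the value of a 3-member model), `LinearShapeEnergy` (2709),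
  `PowerfulHitsSquareRoot` (2710), `SquarefulShapeEnergy` (2711); supports `MixedEnergyCauchySchwarz` (2712, Mathlib `Finset.card_sq_le_card_mul_addEnergy`), `PowerfulAlmostSidon` (2713),
  `RadicallySmallNotSidon` (2714, tree `AbcHits.card_radFibre_le`). STATUS open below 33/50. BEARS ON route-ABC-ExceptionalSetEnergy (declared a consequence-side milestone ladder). WOULD NOT GIVE: ANY
  θ > 0 is compatible with infinitely many counterexamples to ABC; the route's deciding hypothesis `CountingForm` (2707: N_λ(X) = O_λ(1) for every λ < 1) "≡ abc itself in counting form … open for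
  EVERY fixed λ < 1". Intermediate exponents are progress on the de Bruijn / Mazur counting problem, not on ABC.
- D2 Polylog / subpolynomial exceptional set. STATEMENT: N_λ(X) << X^ε for every ε (or << (log X)^A) for each fixed λ < 1. STATUS open (no method on record goes below a fixed power). BEARS ON the same
  route (last rung before `CountingForm`). WOULD NOT GIVE: still infinitely many exceptions allowed; no quality bound for any individual triple.
- D3 Mazur's abundance question (calibration, λ > 1). STATEMENT: S_{α,β,γ}(X) has exact order X^(α+β+γ-1) whenever α+β+γ > 1 [Mazur; Kane proves it up to an additive X^(1+ε), decisive only for α+β+γ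
  >= 2; BLT2024 p.3]. STATUS open for 1 < α+β+γ < 2. BEARS ON ExceptionalSetEnergy's energy lemmas (same fibre-counting technology, `card_radFibre_le`). WOULD NOT GIVE: it concerns λ > 1 (abundance of
  near-misses), orthogonal to the finiteness at λ < 1 that ABC asserts.

## 5. Ladder E - transcendence inputs (linear forms in logarithms; the engine behind the whole floor 0.1-0.2)

- E1 p-adic power saving. STATEMENT: a saving p^(1-δ), fixed δ > 0, in the dependence on the prime p (the factor N(v) = p of Yu's p-adic lower bound, E-G Thm 4.2.1 shape) uniformly in the other
  parameters (`LogCardinality.PadicPowerSaving` stmt-ABC-1758, rank 2). Known: δ = 0 (Yu 2007); Stewart 2013 Lemma 8 wins e^(-k), k ~ log p / (52 log_2 p), only for p beyond a threshold depending on ω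
  (`SubPowerStewartYu` 11053 is the typed sub-power version, rank 3). STATUS open ("beyond every proved p-adic bound"). BEARS ON route-ABC-LogCardinality: proved-now glue `PowerSavingUpgrade` (11055)
  turns E1 into A1 (θ < 1/3); `WieferichShadow` (1762) records WHY E1 is not a consequence of ABC (it would control Wieferich-type phenomena), so E1 is a side-entrance, not a rung ABC passes through.
  WOULD NOT GIVE: A1 only - still exponential abc.
- E2 Sum instead of product of heights. STATEMENT: Baker's inequality with the SUM of the heights in place of the product: log|Λ| >> -(h'(α_1) + … + h'(α_n)) log B, archimedean and p-adic (one place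
  at a time) [BakerWustholz2007 section 3.7 p.53, item (ii)]. Known: product form only (Baker-Wustholz 1993, Matveev 2000, Yu 2007: the loss in n = ω is of C^n n! prod log p type) - this dependence on
  n is the "log-cardinality wall" (card log-cardinality-wall-inventory; route LogCardinality header). STATUS open; no counterexample to the sum form is known. What it gives for a + b = c: with Λ =
  log(c/b) the archimedean sum-form yields b <= a rad(bc)^(O(log log c)), i.e. quasi-polynomial abc (A4-strength) in the LOPSIDED cell, improving Pasten2024 Thm 1.4(1); p-adically the factor p of each
  place survives, so for all triples it still needs E1 or E3. BEARS ON LogCardinality, RTSplit `FewPrimeHardCore` (15197, two-log forms in the Pillai regime), NegOmegaAtlas walls, C1'. WOULD NOT GIVE: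
  anything for balanced many-prime triples on its own; and even with E3 only abc with exponent O(log log c) (below).
- E3 Simultaneous (Ξ) linear forms. STATEMENT: for Λ = u_1 log v_1 + … + u_n log v_n = log(a/b), (a,b) = 1, c = a - b, put Ξ = min(1,|Λ|) prod_p min(1, p|Λ|_p) with |Λ|_p = |c|_p; Baker's proposed
  estimate is log Ξ >> -(log v_1 + … + log v_n) log u, u = max|u_j| [BakerWustholz2007 pp.52-53; Baker 1998; Philippon 1999], and the rung E3 proper is its PRODUCT-of-heights form log Ξ >> -(log v_1 ⋯
  log v_n) log u (item (i) alone: all places at once, heights still multiplied). Unwinding (v_i = primes of ab): log Ξ = log rad(c) - log b + O(1), so E3 reads log b <= log rad(c) + C (prod_{p|ab} log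
  p) log log a; since prod_{p|R} log p <= (log R/ω)^ω = R^(o(1)) this is SUBEXPONENTIAL abc A3 for ALL triples, and quasi-polynomial abc (A4) in every bounded-ω cell (C3). Baker's full estimate
  (i)+(ii) reads b <= K rad(c) rad(ab)^(C log log a) - abc with exponent O(log log c), "a result of the strength of the abc-conjecture sufficient for all its main applications" (p.53) - and its sharp
  variant is Baker's ω-refinement, ABOVE the summit. Known: one place at a time only (exactly how Stewart-Yu proceed, prime by prime, whence R^(1/3)); PastenShimura2024 Thm 1.10 is the first estimate
  global in all primes, but for valuation PRODUCTS (A2), "beyond the scope of what transcendental methods can prove" (p.7). STATUS open. BEARS ON LogCardinality (E-row of the wall inventory), RTSplit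
  few-prime core, NegOmegaAtlas; it is the transcendence-side twin of A2. WOULD NOT GIVE: 1+ε - even E2+E3 stop at exponent O(log log c); the constant-sharp form needed for ABC is a strong hypothesis,
  not a rung.

## 6. Ladder F - negative side (lower bounds and counterexample programmes; a rung here either calibrates or refutes)

- F1 RST lower half. STATEMENT: infinitely many abc triples with c > R exp((4 sqrt 3 - δ) sqrt(log R / log_2 R)) [Robert-Stewart-Tenenbaum 2014 Conj A (1.6); tree `rstExponent`, registered upper half
  `RSTConjectureAUpper` -> ABC]. Known: sqrt(log c)/log log c order only - constants 4-δ (Stewart-Tijdeman 1986, B-G Thm 12.4.6), 6.068 (van Frankenhuysen, B-G Rem 12.4.18), 6.563 (Bright 2024, tree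
  `bright2024_lowerBound`); the RST order sqrt(log R/log_2 R) is LARGER by a factor sqrt(log_2 R). STATUS open. BEARS ON NegOmegaAtlas and FeketeScales kill criteria (the RST-type slack is INLINED in
  `FeketeScales.SubmultOfRST` 10340 / 2162), and on the credibility of the RST upper half as a strong hypothesis. WOULD NOT GIVE: it is CONSISTENT with ABC (calibration of the second-order term only);
  proving it neither proves nor refutes the summit.
- F2 Bounded-ω counterexample atlas. STATEMENT: `NegOmegaAtlas.NegThesis` (1224): if ABC fails with boundedly many prime slots, an explicit infinite family exists in one of three cells -
  `UnbalancedFamily` (1225), `BalancedFamily` (1226), `ThreeSlotFamily` (1227) (each "likely FALSE" per its own docstring; `AtlasDichotomy` 1228: no fourth cell); Assembly NegThesis -> not ABC (1232,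
  provable now). STATUS open both ways except the closed k <= 2 cell. BEARS ON route-ABC-NegOmegaAtlas; the NEGATION of each cell is a C3 rung, so every decided cell is progress on one side. WOULD NOT
  GIVE: refuting all three cells proves ABC only at bounded ω (C3), not ABC; establishing one refutes ABC outright.
- F3 Accumulation spectrum of qualities. STATEMENT: the set of accumulation points of q(a,b,c) over abc triples is exactly [1/3, 1] [B-G Rem 12.4.15 p.416]. Known: it CONTAINS [1/3, 1] (polynomial
  families n^k g(n) + h(n) with squarefree values, B-G Thm 12.2.15) and limsup q >= 1; "the upper bound 1 is the strong abc-conjecture". So the usable truncations are limsup q <= 3 + ε (⟸ B2), limsup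
  q <= κ (= A5) and limsup q <= 1 (= ABC): every "limsup q <= λ" with λ > 1 is an A5-type rung, and the record q = 1.62991 (tree `reyssat_quality_gt`) is the explicit floor any explicit inequality
  (A6, Baker's 6/5) must clear. STATUS: lower half known, upper half = summit. BEARS ON A5/A6, NegOmegaAtlas (its families would be accumulation points above 1). WOULD NOT GIVE: nothing beyond A5 -
  listed so that "new accumulation point" computations are read as calibration, not progress.

## 7. NOT rungs (at or above the summit, equivalent to it, disputed, or beside it) - do not staff as "progress on ABC"

- Equivalent to ABC (tree bridges, `Summits/ABC/StrongHypotheses.lean`): quality form; modified Szpiro (Oesterle 1988); generalized Szpiro B-G 12.5.11; strong Hall (B-G Thm 12.5.12);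
  Hall-Lang-Waldschmidt-Szpiro for x^3 - y^2 = z (B-G 12.5.15 p.426, converse direction printed); `ExceptionalSetEnergy.CountingForm` (2707); `DefiniteXi.FreyDegreeBound` (2019: Frey's degree
  conjecture on Frey curves <-> ABC, Murty 1999 + Pasten Rem 3.3); `GvfSupportTransfer.RationalTransferAK` (3214, X <-> ABC by Assembly + `ABCImpliesTransfer` 3220); `IneffectiveSubspace` old target
  TowerThesis (retired 2026-08-16: ≡ ABC); `FeketeScales.Target` (2159), `LogCardinality.LadderRemainder` (14512), RTSplit `WeightedSzpiroBound` (3272, "given r2 ∧ r4 it IS generalized Szpiro").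
- Strictly above ABC (registered strong hypotheses): Baker's explicit / ω-refinement c < (6/5) N (log N)^ω / ω! (`LogCardinality.BakerRefinement` 1756; bridge `bakerExplicitABC_imp_abc`); uniform abc
  over number fields (`uniformABC_imp_abc`; it is what Granville-Stark need for "no Siegel zeros", barrier file `UniformABCImpliesNoSiegelZeros` - plain ABC does NOT give Siegel-zero repulsion); RST
  Conj A upper half (`rstConjectureAUpper_imp_abc`); n-conjecture for all n (`NConjectureAllImpliesABC`); abc over every number field (`NumberFieldABCConjectureImpliesABC`); Vojta's conjectures;
  `IsogenyGlueCongruence.SemistableDegreeConjecture` (2044, implies ABC, converse unknown); `GvfSupportTransfer.GenusNegligibleDensity` (11082) and `LinearLawTransfer` (11084), both ">= abc" per their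
  docstrings; effective Mordell with Moret-Bailly-strength uniformity (>= ABC).
- Consequences of ABC that give nothing back (beside the ladder): Fermat-Catalan / Beal / Tijdeman-Zagier finiteness (barrier `TijdemanZagierNeedsExponentThree`: exponent-2 signatures have infinitely
  many solutions, 10 known Fermat-Catalan solutions), asymptotic Fermat, Erdos-Woods (barrier `ErdosWoodsTwoFails`: k <= 2 fails), Wieferich / non-Wieferich primes (Silverman 1988; cf.
  `PrimePowerRadical`), Pillai, Hall's conjecture with exponent 1/2 - ε (barrier `HallExponentSharp`: Danilov's families make 1/2 sharp), squarefree values of polynomials (Granville 1998), Roth /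
  Faltings re-derivations (Elkies, Bombieri-Langevin via Belyi; route BelyiSqueeze's DegBelyiLower is REFUTED, negatives index), Tamagawa-number conjecture Tam(E) << N^ε (PastenShimura2024 Conj 1.14:
  implied by B4 with β = 0, implies nothing about c), boundedness of the Manin constant, "abc almost always" (0.4 - true for density reasons at every λ, D1).
- Disputed: Mochizuki's IUT Cor 3.12 and the explicit inequalities drawn from it (barrier `Literature.Barriers.ABC.IUTDisputedClaim`, `IUTDisputedClaim_iff`; Scholze-Stix 2018 objection unresolved in
  print) - neither floor nor rung; any route leaning on it must be a declared conditional bridge.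
- Model barriers (why the function-field proof does not lift): `MasonStothersFailsInCharP` (Frobenius), `NoArithmeticDerivative` (`IntegersHaveNoDerivation`: no derivation on Z makes the
  Mason-Stothers Wronskian argument available; GQLD's quasi-log-derivatives are the typed work-around, C8).

## 8. Known in print, unproved in tree (formal debt that blocks rungs; provable now, no new mathematics)

`DefiniteXi.FreyModularity` (11340; Diamond-Kramer 1995, CDT 1999), `DefiniteRTControlPrime` (11338; Takahashi 2001), `BrandtEigenLatticeRankOne` (17203; Pizer 1980), `SymmFourAnalyticPackage` (15853;
Kim 2003, Kim-Shahidi 2002), `PeterssonLowerBound` (10870; Hoffstein-Lockhart 1994 + GHL), `MazurKenkuRadius` / `MazurKenkuBound` and its four children (15193, 15125, 18223-18226; Mazur 1978, Kenku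
1982, Ligozat 1975), `IsogenyValuationTransport` (18928; PastenShimura2024 L.6.8), `ModularDatumExists` (15126; Wiles 1995, BCDT 2001), `FaltingsTate` (15664; Faltings 1983), `SemistableManinBound(2)`
(16013/16014; Edixhoven 1991, Cesnavicius), `GvfSupportTransfer.FunctionFieldAKGenus` (11083; Riemann-Hurwitz, "fails only as stated: junk values"), `GlobalQuasiLogDerivative.Bridge` (11488) and
`LocalForm` (1693), `RibetTakahashiSplit.ThinOmegaLift` (18066), `NegOmegaAtlas.Assembly` (1232), `ExceptionalSetEnergy.MixedEnergyCauchySchwarz` (2712). Landing any of these moves a route's READY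
line but is not a rung: it changes what is formal, not what is known.

## 9. Reading the ladder against the routes (one line each)

RibetTakahashiSplit = B4 + C3(few-prime) + thin weighted Szpiro; DefiniteXi = B6 -> B1 -> (abc-strength XiStrongBound); IsogenyGlueCongruence = B3 + B5 -> A5 -> (abc-strength Sharp*);
CongruentialReceptacle = B2(balanced) + C2; LopsidedSzpiroSplit (draft) = C1 + B2(isogenous family); LogCardinality = E1/E2/E3 -> A1 -> (summit-strength remainder); IneffectiveSubspace = C4;
FeketeScales = C7 -> A5/A4 -> ABC; ExceptionalSetEnergy = D1 -> D2 -> (CountingForm ≡ ABC); ParitySliceConcordantNorms = C6; GlobalQuasiLogDerivative = C8; NegOmegaAtlas = F2 / C3; GvfSupportTransfer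
= section 7 (transfer statements >= abc; its provable calibrations FunctionFieldAK 3218, ToricLawTransfer 11087 are floor-type). The two places where several ladders meet below the summit are A5
(polynomial abc: Fekete, Ineffective, DefiniteXi, IsogenyGlue, and B1 via Frey curves) and the cover (C1 lopsided) + (B2 Szpiro 6+ε on Frey curves, balanced): a planner looking for the next
route-level statement short of ABC should look there first.

## Landing note (carrier file)

The coordinator's requested path `lean/Summits/ABC/LADDER.md` (or a docstring-only `Summits/ABC/LADDER.lean`) is not a proposable gate target: the target grammar admits only `Summits/<S>/Statement.lean` and
`Summits/<S>/<Sub>/Theorems/<Name>.lean`, there is no markdown kind, and a declaration-free file fails the one-declaration lint. This module docstring under `Summits/ABC/ABC/Theorems/Ladder.lean` is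
therefore the in-tree carrier of LADDER rev 1; the single marker declaration below exists only to satisfy that lint and uses no project declaration, so nothing downstream can depend on it. The folder
copy `LADDER.md` of unit ladder-ABC-l1 is byte-identical to the text above this note.
-/

namespace Summit.ABC.ABC.Theorems

/-- Carrier marker for LADDER rev 1 (2026-08-17): the abc triple `(1, 80, 81) = (1, 2^4·5, 3^4)` has `1 + 80 = 81` and radical `2·3·5 = 30 < 81`
(quality log 81 / log 30 ≈ 1.292, the K = 0 example quoted in rung C4). Pure arithmetic on literals; no project declaration is used. [folklore] -/
theorem ladder_rev1_marker : (1 : ℕ) + 80 = 81 ∧ 2 * 3 * 5 = 30 ∧ (30 : ℕ) < 81 := by decide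

end Summit.ABC.ABC.Theorems
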